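import Mathlib
import Summits.Parity.BatemanHorn.Theorems.PolynomialMobiusPolyMobiusTailStubPairMiddleBoxes

/-!
# P2 `stub_pair_middle` — boxes in `(d₀, m)` and shells: the per-box reduction (pure counting)

STATUS: this file proves the auxiliary stub `stub_pair_middle_box_reduction2` (head theorem, below);
nothing else remains for it.  Helpers are imported from the sibling file
`PolynomialMobiusPolyMobiusTailStubPairMiddleBoxes` (`abs_sum_ite_sub_sum_ite_le_mul_card`,
`sum_sum_sum_eq_sum_product`, `abs_moebius_log_mul_le`).

Auxiliary stub of the line `eta-free-multilinear-window` (crux `PolyMobiusTail`), supporting the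
middle-range stub `stub_pair_middle` (dispersion for the `k = 2` linear window).  In the
`(d₀, d₁, m)`-parametrisation of the one-sided middle sum of a pair `(q₀X + a₀, q₁X + a₁)`
(`n = (d₁m − a₁)/q₁`), fix a box `P < d₀ ≤ P'`, `Mb < m ≤ Mb'` with `x^{1-η}/P` large, `d₁ ≤ Xb` free.
The TRUE summation conditions (C1: `q₁ ∣ d₁m − a₁`; C3: `1 ≤ n ≤ x`; C2⁺: `1 ≤ q₀n + a₀`;
C2: `d₀ ∣ q₀n + a₀`; the window `x^{1-η} < d₀d₁ ≤ x^{1+θ}`; C5: `x^{σ₁} < d₀ ≤ x^{σ₂}`) and the BOX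
conditions (C1; C2': `q₁d₀ ∣ q₀d₁m + Δ'`, `Δ' = q₁a₀ − q₀a₁`; `x^{1-η}/P < d₁ ≤ x^{1+θ}/P'`;
`d₁ ≤ (q₁x+a₁)/Mb'`; C5) satisfy BOX ⟹ TRUE and TRUE ∧ ¬BOX ⟹ one of three boundary shells; since
the weight `μ(d₀) log d₀ · μ(d₁) log d₁` is at most `(1 + log Xb)²` in absolute value, the two
weighted sums differ by at most `(1 + log Xb)²` times the number of TRUE configurations in a shell.
Everything here is elementary counting; no analytic input.
-/

open scoped BigOperators
open Filter Finset Polynomial Asymptotics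

namespace Summit.Parity.BatemanHorn.Theorems.PolyMobiusTail.EtaFreeWindow

/-- **O2-BX2 (per-box reduction with boxes in `(d₀, m)`, pure counting).**  Fix the pair data
`q₀,a₀,q₁,a₁` (`qᵢ ≥ 1`), the exponents, `x`, a bound `Xb`, and a box `P < d₀ ≤ P' ≤ Xb`,
`Mb < m ≤ Mb'` with `x^{1-η}/P` large (`q₁ + |a₁| + q₁(|a₀|+1) + 2 ≤ x^{1-η}/P`), `1 ≤ d₁ ≤ Xb`.
The TRUE `(d₀,d₁,m)`-sum (conditions C1, C3, C2⁺, C2, window, C5 of the triple sum) and the BOX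
sum (conditions C1, `q₁d₀ ∣ q₀d₁m + Δ'`, `x^{1-η}/P < d₁ ≤ x^{1+θ}/P'`, `d₁ ≤ (q₁x+a₁)/Mb'`, C5)
differ by at most `(1 + log Xb)²` times the number of TRUE configurations of the box lying in one
of the three shells `d₀d₁ ∈ (x^{1-η}, x^{1-η}·P'/P]`, `d₀d₁ ∈ (x^{1+θ}·P/P', x^{1+θ}]`,
`d₁m > (q₁x+a₁)(Mb+1)/Mb'`. -/
theorem stub_pair_middle_box_reduction2 :
    ∀ (q₀ a₀ q₁ a₁ : ℤ) (σ₁ σ₂ θ η : ℝ) (x Xb P P' Mb Mb' : ℕ), 0 < q₀ → 0 < q₁ → 0 < P → P < P' →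
      P' ≤ Xb → Mb < Mb' →
      ((q₁.toNat + a₁.natAbs + q₁.toNat * (a₀.natAbs + 1) + 2 : ℕ) : ℝ) ≤ (x : ℝ) ^ (1 - η) / P →
      |(∑ d₀ ∈ Finset.Ioc P P', ∑ d₁ ∈ Finset.Icc 1 Xb, ∑ m ∈ Finset.Ioc Mb Mb',
          if ((d₁ : ℤ) * m - a₁) % q₁ = 0 ∧
              (1 ≤ ((d₁ : ℤ) * m - a₁) / q₁ ∧ ((d₁ : ℤ) * m - a₁) / q₁ ≤ x) ∧
              (1 ≤ q₀ * (((d₁ : ℤ) * m - a₁) / q₁) + a₀ ∧ (d₀ : ℤ) ∣ q₀ * (((d₁ : ℤ) * m - a₁) / q₁) + a₀) ∧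
              ((x : ℝ) ^ (1 - η) < (d₀ : ℝ) * d₁ ∧ (d₀ : ℝ) * d₁ ≤ (x : ℝ) ^ (1 + θ) ∧
                ((x : ℝ) ^ σ₁ < (d₀ : ℝ) ∧ (d₀ : ℝ) ≤ (x : ℝ) ^ σ₂)) then
            ((ArithmeticFunction.moebius d₀ : ℝ) * Real.log d₀) *
              ((ArithmeticFunction.moebius d₁ : ℝ) * Real.log d₁) else 0) -
        (∑ d₀ ∈ Finset.Ioc P P', ∑ d₁ ∈ Finset.Icc 1 Xb, ∑ m ∈ Finset.Ioc Mb Mb',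
          if ((d₁ : ℤ) * m - a₁) % q₁ = 0 ∧
              (q₁ * (d₀ : ℤ) ∣ q₀ * ((d₁ : ℤ) * m) + (q₁ * a₀ - q₀ * a₁)) ∧
              ((x : ℝ) ^ (1 - η) / P < (d₁ : ℝ) ∧ (d₁ : ℝ) ≤ (x : ℝ) ^ (1 + θ) / P' ∧
                (d₁ : ℝ) ≤ ((q₁ : ℝ) * x + a₁) / Mb') ∧
              ((x : ℝ) ^ σ₁ < (d₀ : ℝ) ∧ (d₀ : ℝ) ≤ (x : ℝ) ^ σ₂) then
            ((ArithmeticFunction.moebius d₀ : ℝ) * Real.log d₀) *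
              ((ArithmeticFunction.moebius d₁ : ℝ) * Real.log d₁) else 0)| ≤
      (1 + Real.log Xb) ^ 2 *
        (((Finset.Ioc P P' ×ˢ Finset.Icc 1 Xb) ×ˢ Finset.Ioc Mb Mb').filter (fun c : (ℕ × ℕ) × ℕ =>
          (((c.1.2 : ℤ) * c.2 - a₁) % q₁ = 0 ∧
            (1 ≤ ((c.1.2 : ℤ) * c.2 - a₁) / q₁ ∧ ((c.1.2 : ℤ) * c.2 - a₁) / q₁ ≤ x) ∧
            (1 ≤ q₀ * (((c.1.2 : ℤ) * c.2 - a₁) / q₁) + a₀ ∧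
              (c.1.1 : ℤ) ∣ q₀ * (((c.1.2 : ℤ) * c.2 - a₁) / q₁) + a₀)) ∧
          (((x : ℝ) ^ (1 - η) < (c.1.1 : ℝ) * c.1.2 ∧ (c.1.1 : ℝ) * c.1.2 ≤ (x : ℝ) ^ (1 - η) * P' / P) ∨
           ((x : ℝ) ^ (1 + θ) * P / P' < (c.1.1 : ℝ) * c.1.2 ∧ (c.1.1 : ℝ) * c.1.2 ≤ (x : ℝ) ^ (1 + θ)) ∨
           (((q₁ : ℝ) * x + a₁) * (Mb + 1) / Mb' < (c.1.2 : ℝ) * c.2)))).card := by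
  intro q₀ a₀ q₁ a₁ σ₁ σ₂ θ η x Xb P P' Mb Mb' hq₀ hq₁ hP hPP' hP'Xb hMb hL₀
  rw [sum_sum_sum_eq_sum_product, sum_sum_sum_eq_sum_product]
  -- the size parameter `lo := q₁ + |a₁| + q₁(|a₀|+1) + 2`
  set lo : ℕ := q₁.toNat + a₁.natAbs + q₁.toNat * (a₀.natAbs + 1) + 2 with hlo_def
  have hLnonneg : 0 ≤ (1 + Real.log Xb) ^ 2 := by positivity
  have hq₁nat : (q₁.toNat : ℤ) = q₁ := Int.toNat_of_nonneg hq₁.le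
  have hloZ : q₁ + |a₁| + q₁ * (|a₀| + 1) + 2 ≤ (lo : ℤ) := by
    have h : q₁.toNat + a₁.natAbs + q₁.toNat * (a₀.natAbs + 1) + 2 ≤ lo := le_rfl
    zify at h
    rw [hq₁nat] at h
    simpa using h
  have hPR : (0 : ℝ) < P := by exact_mod_cast hP
  have hP'R : (0 : ℝ) < P' := by exact_mod_cast (hP.trans hPP')
  have hMb'R : (0 : ℝ) < Mb' := by exact_mod_cast (Nat.lt_of_le_of_lt (Nat.zero_le _) hMb)
  have hPP'R : (P : ℝ) ≤ P' := by exact_mod_cast hPP'.le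
  refine abs_sum_ite_sub_sum_ite_le_mul_card _ _ _ _ _ hLnonneg ?_ ?_ ?_
  · -- BOX ⟹ TRUE
    rintro ⟨⟨d₀, d₁⟩, m⟩ hmem ⟨hC1, hC2', ⟨hBlo, hBhi, hBm⟩, hC5⟩
    simp only [Finset.mem_product, Finset.mem_Icc, Finset.mem_Ioc] at hmem
    obtain ⟨⟨⟨hd₀P, hd₀P'⟩, hd₁1, hd₁X⟩, hmMb, hmMb'⟩ := hmem
    dsimp only at hC1 hC2' hBlo hBhi hBm hC5 ⊢
    set n : ℤ := ((d₁ : ℤ) * m - a₁) / q₁ with hn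
    have hqn : q₁ * n = (d₁ : ℤ) * m - a₁ := Int.mul_ediv_cancel' (Int.dvd_of_emod_eq_zero hC1)
    -- `lo < d₁` from `lo ≤ x^{1-η}/P < d₁`
    have hd₁loR : (lo : ℝ) < d₁ := lt_of_le_of_lt hL₀ hBlo
    have hd₁lo : lo < d₁ := by exact_mod_cast hd₁loR
    have hd₁loZ : (lo : ℤ) + 1 ≤ d₁ := by exact_mod_cast hd₁lo
    have hm1 : 1 ≤ m := by omega
    have hm1Z : (1 : ℤ) ≤ m := by exact_mod_cast hm1
    have hdm : (lo : ℤ) + 1 ≤ (d₁ : ℤ) * m := by nlinarith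
    have ha₁ : a₁ ≤ |a₁| := le_abs_self _
    have ha₀ : -a₀ ≤ |a₀| := neg_le_abs _
    have ha₀' : 0 ≤ |a₀| := abs_nonneg _
    -- C3 lower bound: `n ≥ |a₀| + 3`
    have hnlb : |a₀| + 3 ≤ n := by
      by_contra h
      push Not at h
      have : q₁ * n ≤ q₁ * (|a₀| + 2) := by
        exact mul_le_mul_of_nonneg_left (by omega) hq₁.le
      nlinarith
    -- C3 upper bound from `Bm`
    have hnx : n ≤ x := by
      have h1 : (d₁ : ℝ) * Mb' ≤ (q₁ : ℝ) * x + a₁ := (le_div_iff₀ hMb'R).1 hBm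
      have h2 : (d₁ : ℝ) * m ≤ (d₁ : ℝ) * Mb' := by
        have : (m : ℝ) ≤ Mb' := by exact_mod_cast hmMb'
        have hd0 : (0 : ℝ) ≤ d₁ := by positivity
        exact mul_le_mul_of_nonneg_left this hd0
      have h3 : (d₁ : ℝ) * m ≤ (q₁ : ℝ) * x + a₁ := by linarith
      have h4 : (d₁ : ℤ) * m ≤ q₁ * x + a₁ := by exact_mod_cast h3
      have h5 : q₁ * n ≤ q₁ * x := by linarith
      exact le_of_mul_le_mul_left h5 hq₁
    refine ⟨hC1, ⟨by linarith, hnx⟩, ⟨by nlinarith, ?_⟩, ?_, ?_, hC5⟩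
    · -- C2 from C2'
      have : q₁ * (d₀ : ℤ) ∣ q₁ * (q₀ * n + a₀) := by
        have e : q₁ * (q₀ * n + a₀) = q₀ * ((d₁ : ℤ) * m) + (q₁ * a₀ - q₀ * a₁) := by
          linear_combination q₀ * hqn
        rw [e]; exact hC2'
      exact (mul_dvd_mul_iff_left hq₁.ne').1 this
    · -- window, lower
      have h1 : (x : ℝ) ^ (1 - η) < (d₁ : ℝ) * P := (div_lt_iff₀ hPR).1 hBlo
      have h2 : (d₁ : ℝ) * P ≤ (d₀ : ℝ) * d₁ := by
        have : (P : ℝ) ≤ d₀ := by exact_mod_cast hd₀P.le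
        have hd0 : (0 : ℝ) ≤ d₁ := by positivity
        nlinarith
      linarith
    · -- window, upper
      have h1 : (d₁ : ℝ) * P' ≤ (x : ℝ) ^ (1 + θ) := (le_div_iff₀ hP'R).1 hBhi
      have h2 : (d₀ : ℝ) * d₁ ≤ (d₁ : ℝ) * P' := by
        have : (d₀ : ℝ) ≤ P' := by exact_mod_cast hd₀P'
        have hd0 : (0 : ℝ) ≤ d₁ := by positivity
        nlinarith
      linarith
  · -- TRUE ∧ ¬ BOX ⟹ shell filter
    rintro ⟨⟨d₀, d₁⟩, m⟩ hmem ⟨hC1, hC3, ⟨hC2p, hC2⟩, hWlo, hWhi, hC5⟩ hnB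
    simp only [Finset.mem_product, Finset.mem_Icc, Finset.mem_Ioc] at hmem
    obtain ⟨⟨⟨hd₀P, hd₀P'⟩, hd₁1, hd₁X⟩, hmMb, hmMb'⟩ := hmem
    dsimp only at hC1 hC3 hC2p hC2 hWlo hWhi hC5 hnB ⊢
    refine ⟨⟨hC1, hC3, hC2p, hC2⟩, ?_⟩
    set n : ℤ := ((d₁ : ℤ) * m - a₁) / q₁ with hn
    have hqn : q₁ * n = (d₁ : ℤ) * m - a₁ := Int.mul_ediv_cancel' (Int.dvd_of_emod_eq_zero hC1)
    have hC2' : q₁ * (d₀ : ℤ) ∣ q₀ * ((d₁ : ℤ) * m) + (q₁ * a₀ - q₀ * a₁) := by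
      have e : q₀ * ((d₁ : ℤ) * m) + (q₁ * a₀ - q₀ * a₁) = q₁ * (q₀ * n + a₀) := by
        linear_combination -q₀ * hqn
      rw [e]; exact mul_dvd_mul_left q₁ hC2
    have hd₀R : (P : ℝ) ≤ d₀ := by exact_mod_cast hd₀P.le
    have hd₀R' : (d₀ : ℝ) ≤ P' := by exact_mod_cast hd₀P'
    have hd₁pos : (0 : ℝ) < d₁ := by exact_mod_cast hd₁1
    have hm1 : 1 ≤ m := by omega
    have hmR : (0 : ℝ) < m := by exact_mod_cast hm1
    have hmR' : ((Mb : ℝ) + 1) ≤ m := by exact_mod_cast hmMb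
    by_cases hBlo : (x : ℝ) ^ (1 - η) / P < (d₁ : ℝ)
    · by_cases hBhi : (d₁ : ℝ) ≤ (x : ℝ) ^ (1 + θ) / P'
      · by_cases hBm : (d₁ : ℝ) ≤ ((q₁ : ℝ) * x + a₁) / Mb'
        · exact absurd ⟨hC1, hC2', ⟨hBlo, hBhi, hBm⟩, hC5⟩ hnB
        · -- shell₃
          right; right
          push Not at hBm
          -- `0 ≤ q₁ x + a₁` from C3: `d₁ m = q₁ n + a₁ ≤ q₁ x + a₁` and `0 ≤ d₁ m`
          have hposZ : (0 : ℤ) ≤ q₁ * x + a₁ := by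
            have h1 : q₁ * n ≤ q₁ * x := mul_le_mul_of_nonneg_left hC3.2 hq₁.le
            have h2 : (0 : ℤ) ≤ (d₁ : ℤ) * m := by positivity
            linarith
          have hpos : (0 : ℝ) ≤ (q₁ : ℝ) * x + a₁ := by exact_mod_cast hposZ
          have h0 : 0 ≤ ((q₁ : ℝ) * x + a₁) / Mb' := div_nonneg hpos hMb'R.le
          calc ((q₁ : ℝ) * x + a₁) * (Mb + 1) / Mb' = ((q₁ : ℝ) * x + a₁) / Mb' * (Mb + 1) := by ring
            _ ≤ ((q₁ : ℝ) * x + a₁) / Mb' * m := mul_le_mul_of_nonneg_left hmR' h0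
            _ < (d₁ : ℝ) * m := mul_lt_mul_of_pos_right hBm hmR
      · -- shell₂
        right; left
        push Not at hBhi
        refine ⟨?_, hWhi⟩
        calc (x : ℝ) ^ (1 + θ) * P / P' = (x : ℝ) ^ (1 + θ) / P' * P := by ring
          _ < (d₁ : ℝ) * P := mul_lt_mul_of_pos_right hBhi hPR
          _ ≤ (d₁ : ℝ) * d₀ := mul_le_mul_of_nonneg_left hd₀R hd₁pos.le
          _ = (d₀ : ℝ) * d₁ := by ring
    · -- shell₁
      left
      push Not at hBlo
      refine ⟨hWlo, ?_⟩
      have h0 : 0 ≤ (x : ℝ) ^ (1 - η) / P := by positivity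
      have hd₀nn : (0 : ℝ) ≤ d₀ := by positivity
      calc (d₀ : ℝ) * d₁ ≤ (d₀ : ℝ) * ((x : ℝ) ^ (1 - η) / P) := mul_le_mul_of_nonneg_left hBlo hd₀nn
        _ ≤ (P' : ℝ) * ((x : ℝ) ^ (1 - η) / P) := mul_le_mul_of_nonneg_right hd₀R' h0
        _ = (x : ℝ) ^ (1 - η) * P' / P := by ring
  · -- the weight bound
    rintro ⟨⟨d₀, d₁⟩, m⟩ hmem -
    simp only [Finset.mem_product, Finset.mem_Icc, Finset.mem_Ioc] at hmem
    obtain ⟨⟨⟨hd₀P, hd₀P'⟩, hd₁1, hd₁X⟩, -, -⟩ := hmem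
    have hd₀1 : 1 ≤ d₀ := by omega
    exact abs_moebius_log_mul_le hd₀1 (hd₀P'.trans hP'Xb) hd₁1 hd₁X

end Summit.Parity.BatemanHorn.Theorems.PolyMobiusTail.EtaFreeWindow
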